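import Summits.QuantumFields.YangMills.Theorems.BalabanUVNodesN19VarianceOfAnalyticTiltFamily
import Summits.QuantumFields.YangMills.Theorems.BalabanUVNodesN19TameConditionedHellingerLetterAlongK
import Summits.QuantumFields.YangMills.Theorems.BalabanUVNodesN20HellingerRoadOfVarianceAndResponse

/-!
# BalabanUVNodes ∕ node N19 (NE7) — THE TAME REGIME LETTER IS IDLE: the regime-free, ONE-tilt edition of the tame Hellinger letter
# (idea-3's hellinger road, letters (KR)+(V‑b) on the tame side; composed BY NAME from three landed files)

Cell `pub-ymgap` (HUMAN RULING D-0062 Track A ∕ director-ym R399 (3a) second-wave width seats), WIDTH SEAT `pub-ymgap-dag-n19-w4` (node n19 = NE7),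
generation g8, CLAIM-1 ∕ INTENT-1 (bus 2026-08-28T10:45Z, INBOX l.36200).  Key item K3⁸ `SpineGivenEndpointR13SepCoPHV` (stmt-QuantumFields-27366,
skeleton of record v6 b4e55110ab73e679, stub 2 `stub_expansion13HV`; payload key K3⁷ stmt-QuantumFields-20544 aside per KEY MAP v2 — this file is Params-free,
hence version-free); filed `--kind proof --supports … --as helper`.  COUNT-NEUTRAL.  THEOREMS ONLY (0 `def`, 0 `instance`, 0 `notation`, 0 `sorry`).
ADDITIVE — imports this seat's g5 p616152 `…N19VarianceOfAnalyticTiltFamily` and g6 p618979 `…N19TameConditionedHellingerLetterAlongK`, and dag-n20-w4 g2's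
p612607 `…N20HellingerRoadOfVarianceAndResponse`, BY NAME; modifies nothing, re-declares nothing.

WHY.  The K-summation of record of idea-3's hellinger road on the TAME side — p618979 `affinityDefectLetter_of_tameTilts` (and, downstream BY NAME,
p620730 `…_of_kpMargins`, dag-n20-w5's p622199 `…_of_refreshProcesses_and_tameTilts`, dag-n20-w4's p623082 `…_of_slotDoms_and_kpMargins`, the capstone
p623765) — carries, besides the wild-mass block (V‑a), the radii `Σ_K 1∕r_K < ∞` ((V‑b)) and ONE tilt bound `𝔅`, three more letters per `(K,t)`: TWO tilt
branches `φA`, `φB` (one per run) on the origin disc `closedBall 0 r_K`, and the TAME REGIME `1 − 𝒜_tame ≤ 1∕16` from some `K₀` on.  The regime entered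
because the V-side kernel of record (dag-n20-w5's p616874, Padé + bootstrap) reads the tilt branches only through the two ENDPOINT variances, and endpoint
variances alone do not control the interior of the interpolation segment (dag-n20-w4 g2 `exists_endpointVar_le_and_not_uniformVar`; dag-n20-w5's p619159
§3 «the regime cannot be dropped» — for endpoint variances, correct and untouched here).  THIS FILE observes that the origin-disc letter says MORE:
once `r ≥ 2` the disc `closedBall 0 r` contains the `r∕2`-neighbourhood of the whole segment `[0,1]`, so ONE branch `φA` gives the s-UNIFORM variance
letter of p612607 by this seat's p616152 (`uniformVar_le_of_sup_bound_on_segment`, Cauchy estimates disc by disc), and p612607's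
`one_sub_affinity_le_var_div_eight` (the midpoint log-convexity defect of the interpolated class free energy — NO bootstrap) turns it into
`1 − 𝒜_tame ≤ 2𝔅∕r²`.  The radius letter `Σ_K 1∕r_K < ∞` the road already carries forces `r_K ≥ 2` off a finite head, where the trivial bound `1 − 𝒜 ≤ 1` is
summable.  Hence the REGIME letter and the SECOND tilt branch are IDLE: the (H) letter follows from the wild-mass block + radii + ONE tilt branch per `(K,t)`.
* §1 ★ `uniformVar_le_of_originDisc_tilt` (ONE class set: origin-disc branch, `r ≥ 2`, `‖φ‖ ≤ 𝔅` ⇒ p612607's `hV` letter VERBATIM with `V := 16𝔅∕r²`) ·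
  ★★ `one_sub_affinity_classLaw_le_of_originDisc_tilt` (⇒ `1 − Σ_S √(p_A p_B) ≤ 2𝔅∕r²` — NO regime, ONE branch; cf. p618660's
  `one_sub_affinity_classLaw_le_of_analytic_tilts`: two branches + regime ⇒ `(B_A+B_B)∕(2r²)`).
* §2 ★★ `one_sub_affinity_classLaw_le_wildMass_add_tameTilt` (R2 — p618660 `one_sub_affinity_classLaw_le_wildMass_add_restricted` BY NAME — then §1 on the
  tame set `T ∖ W`: `1 − Σ_T √(p_A p_B) ≤ max(Σ_W A∕Σ_T A, Σ_W B∕Σ_T B) + 2𝔅∕r²`; = p618979 §1 minus `hreg`, minus `φB`).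
* §3 ★★★ `affinityDefectLetter_of_tameTilt` (ALONG `K`: wild-mass block + radii + ONE branch per `(K,t)` + ONE bound ⇒ `∃ η ≥ 0, Σ√η_K < ∞, 1 − 𝒜_K(t) ≤ η_K`)
  · ★★ `affinityDefectLetter_of_tameTilts_regimeFree` (DROP-IN: p618979's binder list VERBATIM with `(K₀) (hreg)` DELETED — a consumer removes two arguments)
  · `hellingerRate_of_tameTilt` (the ρ-shape, via p618979 `exists_summable_sqrt_rate`).
* §4 `toy_identicalRuns` (A6: the letters of §2 are jointly inhabited — identical runs, `φ = 0`, `𝔅 = 0`, `r = 2`, and §2 returns `1 − 𝒜 ≤ wild`).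
CREDIT.  The road, R2 and the K-summation: idea-3 g10–g14 ∕ CRIT-1 g5; the midpoint-defect calculus and `1 − 𝒜 ≤ V∕8`: dag-n20-w4 g2 (p611539, p612607) —
CONSUMED BY NAME; the disc-by-disc Cauchy estimate: this seat g5 (p614272, p616152); R2 in the tree: this seat g6 (p618660).  New here: the inclusion
`closedBall s (r∕2) ⊆ closedBall 0 r` for `s ∈ [0,1]`, `r ≥ 2`, and the bookkeeping that removes the regime and the second branch from every (H) supplier.
Consumers: dag-n20-w5's capstone `exists_hybridNE7_of_affinityDefectLetter_and_response` ∕ `…_boundedCurrent` take ANY (H) supplier in this ∃-shape — feed §3.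

HONEST FRAMING.  [folklore] one-variable complex analysis + finite sums on HYPOTHESIS SHAPES, composed by name.  EVERY remaining letter — the wild masses
with `Σ_K √wm_K < ∞` ((V‑a)), the radii with `Σ_K 1∕r_K < ∞` ((V‑b) = (YG), a two-run statement, UNPRINTED for d = 4), the tilt branch with its bound `𝔅`
((KR) on tame components) — is a HYPOTHESIS produced by nobody, NOT asserted here; what moves is one letter OFF the list (the regime) and one branch (φB),
nothing else; NO estimate of Bałaban's programme is proved; nothing of Bałaban's asserted or instantiated (no `Provisos₁₃SepCoPH` tuple — K0⁷ OPEN);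
(R′), (R‑c) untouched; NE7 ∕ NE7b ∕ NE7c NOT PRINTED as two-run statements for d = 4 and NOT proved; N19 ∕ N20 NOT discharged; K3⁸ ∕ K3⁷ OPEN, not claimed;
no summit statement is proved by this seat; counts UNMOVED (typed 28∕28 · discharged 5∕27, A 5∕28).  One finite four-torus programme at fixed ε — NOT ℝ⁴,
NOT infinite volume, NOT OS, NOT a mass gap, NOT the Clay problem (R4 closes the conditional finite-𝕋⁴ rung `BalabanLadder.UV` only).  0 `def`; 0 `sorry`;
standard axioms; no cite tags.
-/

noncomputable section

namespace Summit.QuantumFields.YangMills.BalabanUVNodes.N19TameHellingerLetterRegimeFree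

open Finset
open Summit.QuantumFields.YangMills.BalabanUVNodes.N19VarianceOfAnalyticTiltFamily (uniformVar_le_of_sup_bound_on_segment)
open Summit.QuantumFields.YangMills.BalabanUVNodes.N20HellingerRoadOfVarianceAndResponse (one_sub_affinity_le_var_div_eight)
open Summit.QuantumFields.YangMills.BalabanUVNodes.N19TameConditionedHellingerLetter (one_sub_affinity_classLaw_le_wildMass_add_restricted)
open Summit.QuantumFields.YangMills.BalabanUVNodes.N19TameConditionedHellingerLetterAlongK (exists_summable_sqrt_rate)

variable {ι : Type*}

/-! ## §1 ONE class set: an origin-disc tilt branch of radius `r ≥ 2` ⇒ the s-uniform variance letter ⇒ `1 − 𝒜 ≤ 2𝔅∕r²`, NO regime [folklore] -/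

section OneKey
variable {S : Finset ι} {A B : ι → ℝ}

/-- [folklore] for `r ≥ 2` and `s ∈ [0,1]` the disc `closedBall (s:ℂ) (r∕2)` lies inside the origin disc `closedBall 0 r` — the one geometric fact that lets
ONE origin-disc branch serve the whole interpolation segment. -/
theorem closedBall_segment_subset_closedBall_zero {r : ℝ} (hr : 2 ≤ r) :
    ∀ s ∈ Set.Icc (0:ℝ) 1, Metric.closedBall (s:ℂ) (r / 2) ⊆ Metric.closedBall (0:ℂ) r := by
  intro s hs z hz
  rw [Metric.mem_closedBall] at hz ⊢
  have h1 := dist_triangle z (s:ℂ) 0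
  have h2 : dist (s:ℂ) 0 ≤ 1 := by
    rw [dist_zero_right, Complex.norm_real, Real.norm_eq_abs, abs_le]
    constructor <;> linarith [hs.1, hs.2]
  linarith

/-- **★ THE s-UNIFORM VARIANCE LETTER FROM ONE ORIGIN-DISC TILT BRANCH** [folklore].  Positive weights `A` on a finite class set `S`, any `B`, the two-run
increment `h = log B − log A`; ONE branch `φ` of `log (Σ_S A e^{zh} ∕ Σ_S A)`, complex differentiable on `closedBall 0 r` with `r ≥ 2` and `‖φ‖ ≤ 𝔅` there
(the `φA` conjuncts of p618979's `htilt`, VERBATIM) ⇒ for EVERY `s ∈ [0,1]`, `Var_{μ_s}(h) ≤ 16𝔅∕r²` in the moment form of dag-n20-w4's p612607 `hV` —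
this seat's p616152 `uniformVar_le_of_sup_bound_on_segment` on the discs `closedBall s (r∕2) ⊆ closedBall 0 r`. -/
theorem uniformVar_le_of_originDisc_tilt (hA : ∀ τ ∈ S, 0 < A τ) {r 𝔅 : ℝ} (hr : 2 ≤ r) (φ : ℂ → ℂ)
    (hφ : DifferentiableOn ℂ φ (Metric.closedBall 0 r))
    (hexp : ∀ s ∈ Metric.closedBall (0:ℂ) r, Complex.exp (φ s)
      = (∑ τ ∈ S, (A τ : ℂ) * Complex.exp (s * ((Real.log (B τ) - Real.log (A τ) : ℝ) : ℂ))) / ∑ τ ∈ S, (A τ : ℂ))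
    (hb : ∀ s ∈ Metric.closedBall (0:ℂ) r, ‖φ s‖ ≤ 𝔅) :
    ∀ s ∈ Set.Icc (0:ℝ) 1,
      (∑ τ ∈ S, A τ * Real.exp (s * (Real.log (B τ) - Real.log (A τ))) * (Real.log (B τ) - Real.log (A τ)) ^ 2)
          / (∑ τ ∈ S, A τ * Real.exp (s * (Real.log (B τ) - Real.log (A τ))))
        - ((∑ τ ∈ S, A τ * Real.exp (s * (Real.log (B τ) - Real.log (A τ))) * (Real.log (B τ) - Real.log (A τ)))
          / (∑ τ ∈ S, A τ * Real.exp (s * (Real.log (B τ) - Real.log (A τ))))) ^ 2 ≤ 16 * 𝔅 / r ^ 2 := by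
  intro s hs
  have hr0 : 0 < r := by linarith
  have h := uniformVar_le_of_sup_bound_on_segment S A (fun τ => Real.log (B τ) - Real.log (A τ)) hA (half_pos hr0) φ hφ
    (closedBall_segment_subset_closedBall_zero hr) hexp hb s hs
  have e : 4 * 𝔅 / (r / 2) ^ 2 = 16 * 𝔅 / r ^ 2 := by
    field_simp
    ring
  rw [e] at h
  exact h

/-- **★★ ONE MINUS THE HELLINGER AFFINITY FROM ONE ORIGIN-DISC TILT BRANCH — NO REGIME** [folklore].  Positive class weights `A, B` of the two runs on a
finite class set `S`; ONE branch `φ` of `log (Σ_S A e^{z(log B − log A)} ∕ Σ_S A)` on `closedBall 0 r`, `r ≥ 2`, `‖φ‖ ≤ 𝔅` ⇒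
`1 − Σ_S √(p_A p_B) ≤ 2𝔅∕r²` (`p_A = A∕Σ_S A`, `p_B = B∕Σ_S B`): §1's s-uniform variance letter fed to dag-n20-w4's `one_sub_affinity_le_var_div_eight`
(`1 − 𝒜 ≤ V∕8`, the midpoint log-convexity defect — no bootstrap, hence no a-priori regime).  `S ≠ ∅` is forced by `hexp` at `0`.  Compare p618660
`one_sub_affinity_classLaw_le_of_analytic_tilts`: TWO branches + the regime `1 − 𝒜 ≤ 1∕16` ⇒ `(B_A+B_B)∕(2r²)`. -/
theorem one_sub_affinity_classLaw_le_of_originDisc_tilt (hA : ∀ τ ∈ S, 0 < A τ) (hB : ∀ τ ∈ S, 0 < B τ) {r 𝔅 : ℝ} (hr : 2 ≤ r)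
    (φ : ℂ → ℂ) (hφ : DifferentiableOn ℂ φ (Metric.closedBall 0 r))
    (hexp : ∀ s ∈ Metric.closedBall (0:ℂ) r, Complex.exp (φ s)
      = (∑ τ ∈ S, (A τ : ℂ) * Complex.exp (s * ((Real.log (B τ) - Real.log (A τ) : ℝ) : ℂ))) / ∑ τ ∈ S, (A τ : ℂ))
    (hb : ∀ s ∈ Metric.closedBall (0:ℂ) r, ‖φ s‖ ≤ 𝔅) :
    1 - ∑ τ ∈ S, Real.sqrt ((A τ / ∑ σ ∈ S, A σ) * (B τ / ∑ σ ∈ S, B σ)) ≤ 2 * 𝔅 / r ^ 2 := by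
  have hr0 : 0 < r := by linarith
  -- the class set is nonempty: `exp (φ 0) = Σ_S A ∕ Σ_S A` cannot vanish
  have hS : S.Nonempty := by
    rcases S.eq_empty_or_nonempty with h0 | h1
    · exfalso
      have h := hexp 0 (Metric.mem_closedBall_self hr0.le)
      rw [h0, sum_empty, sum_empty, zero_div] at h
      exact Complex.exp_ne_zero _ h
    · exact h1
  have hV := uniformVar_le_of_originDisc_tilt hA hr φ hφ hexp hb
  have h := one_sub_affinity_le_var_div_eight hS hA hB hV
  have e : 16 * 𝔅 / r ^ 2 / 8 = 2 * 𝔅 / r ^ 2 := by ring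
  linarith

end OneKey

/-! ## §2 ONE `(K,t)`: R2 (tame conditioning, p618660) + §1 on the tame set — WILD MASS + ONE TAME TILT, NO regime [folklore] -/

section Composition
variable [DecidableEq ι] {T : Finset ι} {A B : ι → ℝ}

/-- **★★ THE ONE-`(K,t)` HELLINGER LETTER FROM WILD MASS AND ONE TAME TILT BRANCH — NO REGIME** [folklore; = p618979 §1
`one_sub_affinity_classLaw_le_wildMass_add_tameTilts` with `φB ∕ hφB ∕ hexpB ∕ hbB` and `hreg` DELETED, radius asked `≥ 2`].  Positive class weights `A, B`
of the two runs on the keyed class set `T`, a wild set `W ⊆ T`; ONE branch `φ` of `log (Σ_{T∖W} A e^{z(log B − log A)} ∕ Σ_{T∖W} A)` on `closedBall 0 r`,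
`r ≥ 2`, `‖φ‖ ≤ 𝔅` ⇒ `1 − Σ_T √(p_A p_B) ≤ max(Σ_W A∕Σ_T A, Σ_W B∕Σ_T B) + 2𝔅∕r²` — WILD classes cost the larger of their two one-run masses (R2, p618660
`one_sub_affinity_classLaw_le_wildMass_add_restricted` BY NAME), TAME classes cost one tilt bound over `r²` (§1).  `T ∖ W ≠ ∅` is forced by `hexp` at `0`. -/
theorem one_sub_affinity_classLaw_le_wildMass_add_tameTilt {W : Finset ι} (hW : W ⊆ T)
    (hA : ∀ τ ∈ T, 0 < A τ) (hB : ∀ τ ∈ T, 0 < B τ) {r 𝔅 : ℝ} (hr : 2 ≤ r) (φ : ℂ → ℂ)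
    (hφ : DifferentiableOn ℂ φ (Metric.closedBall 0 r))
    (hexp : ∀ s ∈ Metric.closedBall (0:ℂ) r, Complex.exp (φ s)
      = (∑ τ ∈ T \ W, (A τ : ℂ) * Complex.exp (s * ((Real.log (B τ) - Real.log (A τ) : ℝ) : ℂ))) / ∑ τ ∈ T \ W, (A τ : ℂ))
    (hb : ∀ s ∈ Metric.closedBall (0:ℂ) r, ‖φ s‖ ≤ 𝔅) :
    1 - ∑ τ ∈ T, Real.sqrt ((A τ / ∑ σ ∈ T, A σ) * (B τ / ∑ σ ∈ T, B σ))
      ≤ max ((∑ τ ∈ W, A τ) / ∑ σ ∈ T, A σ) ((∑ τ ∈ W, B τ) / ∑ σ ∈ T, B σ) + 2 * 𝔅 / r ^ 2 := by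
  have hr0 : 0 < r := by linarith
  -- the tame set is nonempty: `exp (φ 0) = Σ_{T∖W} A ∕ Σ_{T∖W} A` cannot vanish
  have hne : (T \ W).Nonempty := by
    rcases (T \ W).eq_empty_or_nonempty with h0 | h1
    · exfalso
      have h := hexp 0 (Metric.mem_closedBall_self hr0.le)
      rw [h0, sum_empty, sum_empty, zero_div] at h
      exact Complex.exp_ne_zero _ h
    · exact h1
  have h1 := one_sub_affinity_classLaw_le_wildMass_add_restricted hW hA hB hne
  have h2 := one_sub_affinity_classLaw_le_of_originDisc_tilt (S := T \ W)
    (fun τ hτ => hA τ (sdiff_subset hτ)) (fun τ hτ => hB τ (sdiff_subset hτ)) hr φ hφ hexp hb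
  linarith

/-- **… in HELLINGER (square-root) currency** [folklore]: under the same hypotheses
`√(1 − Σ_T √(p_A p_B)) ≤ √(max(Σ_W A∕Σ_T A, Σ_W B∕Σ_T B)) + √(2𝔅)∕r` — the summand shape of the K-summation. -/
theorem sqrt_one_sub_affinity_classLaw_le_wildMass_add_tameTilt {W : Finset ι} (hW : W ⊆ T)
    (hA : ∀ τ ∈ T, 0 < A τ) (hB : ∀ τ ∈ T, 0 < B τ) {r 𝔅 : ℝ} (hr : 2 ≤ r) (φ : ℂ → ℂ)
    (hφ : DifferentiableOn ℂ φ (Metric.closedBall 0 r))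
    (hexp : ∀ s ∈ Metric.closedBall (0:ℂ) r, Complex.exp (φ s)
      = (∑ τ ∈ T \ W, (A τ : ℂ) * Complex.exp (s * ((Real.log (B τ) - Real.log (A τ) : ℝ) : ℂ))) / ∑ τ ∈ T \ W, (A τ : ℂ))
    (hb : ∀ s ∈ Metric.closedBall (0:ℂ) r, ‖φ s‖ ≤ 𝔅) :
    Real.sqrt (1 - ∑ τ ∈ T, Real.sqrt ((A τ / ∑ σ ∈ T, A σ) * (B τ / ∑ σ ∈ T, B σ)))
      ≤ Real.sqrt (max ((∑ τ ∈ W, A τ) / ∑ σ ∈ T, A σ) ((∑ τ ∈ W, B τ) / ∑ σ ∈ T, B σ))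
        + Real.sqrt (2 * 𝔅) / r := by
  have hr0 : 0 < r := by linarith
  have h := one_sub_affinity_classLaw_le_wildMass_add_tameTilt hW hA hB hr φ hφ hexp hb
  have hne : (T \ W).Nonempty := by
    rcases (T \ W).eq_empty_or_nonempty with h0 | h1
    · exfalso
      have h' := hexp 0 (Metric.mem_closedBall_self hr0.le)
      rw [h0, sum_empty, sum_empty, zero_div] at h'
      exact Complex.exp_ne_zero _ h'
    · exact h1
  have hT : T.Nonempty := hne.mono sdiff_subset
  have hZA : 0 < ∑ σ ∈ T, A σ := sum_pos hA hT
  have hm0 : 0 ≤ max ((∑ τ ∈ W, A τ) / ∑ σ ∈ T, A σ) ((∑ τ ∈ W, B τ) / ∑ σ ∈ T, B σ) :=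
    le_trans (div_nonneg (sum_nonneg fun τ hτ => (hA τ (hW hτ)).le) hZA.le) (le_max_left _ _)
  -- `𝔅 ≥ 0` is forced: a norm bound at the centre of the disc
  have h𝔅 : 0 ≤ 𝔅 := (norm_nonneg _).trans (hb 0 (Metric.mem_closedBall_self hr0.le))
  have htil : 0 ≤ 2 * 𝔅 / r ^ 2 := by positivity
  -- `√(a + b) ≤ √a + √b`, inlined (as in p618979) to keep the imports local
  have hsub : ∀ {a b : ℝ}, 0 ≤ a → 0 ≤ b → Real.sqrt (a + b) ≤ Real.sqrt a + Real.sqrt b := fun {a b} ha hb => by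
    rw [Real.sqrt_le_left (by positivity)]
    nlinarith [Real.sq_sqrt ha, Real.sq_sqrt hb, mul_nonneg (Real.sqrt_nonneg a) (Real.sqrt_nonneg b)]
  calc Real.sqrt (1 - ∑ τ ∈ T, Real.sqrt ((A τ / ∑ σ ∈ T, A σ) * (B τ / ∑ σ ∈ T, B σ)))
      ≤ Real.sqrt (max ((∑ τ ∈ W, A τ) / ∑ σ ∈ T, A σ) ((∑ τ ∈ W, B τ) / ∑ σ ∈ T, B σ) + 2 * 𝔅 / r ^ 2) :=
        Real.sqrt_le_sqrt h
    _ ≤ Real.sqrt (max ((∑ τ ∈ W, A τ) / ∑ σ ∈ T, A σ) ((∑ τ ∈ W, B τ) / ∑ σ ∈ T, B σ))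
          + Real.sqrt (2 * 𝔅 / r ^ 2) := hsub hm0 htil
    _ = Real.sqrt (max ((∑ τ ∈ W, A τ) / ∑ σ ∈ T, A σ) ((∑ τ ∈ W, B τ) / ∑ σ ∈ T, B σ))
          + Real.sqrt (2 * 𝔅) / r := by
        rw [Real.sqrt_div' _ (by positivity : (0:ℝ) ≤ r ^ 2), Real.sqrt_sq hr0.le]

end Composition

/-! ## §3 ALONG `K`: the (H) letter from the wild-mass block, the radii and ONE tilt branch per `(K,t)` — regime-free [folklore] -/

section Summation
variable [DecidableEq ι] {l₀ : ℝ}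

/-- [folklore] the radius letter `Σ_K 1∕r_K < ∞` (with `r_K > 0`) forces `r_K ≥ 2` from some `K₁` on — the finite head is where the regime letter used
to be spent; here it is paid by the trivial bound `1 − 𝒜 ≤ 1`. -/
theorem exists_forall_two_le_of_summable_one_div {r : ℕ → ℝ} (hr : ∀ K, 0 < r K) (hrs : Summable fun K => 1 / r K) :
    ∃ K₁ : ℕ, ∀ K, K₁ ≤ K → 2 ≤ r K := by
  have hev : ∀ᶠ K in Filter.atTop, 1 / r K < 1 / 2 :=
    (tendsto_order.1 hrs.tendsto_atTop_zero).2 _ (by norm_num)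
  obtain ⟨K₁, hK₁⟩ := Filter.eventually_atTop.1 hev
  refine ⟨K₁, fun K hK => ?_⟩
  by_contra hlt
  have hle : r K ≤ 2 := le_of_lt (not_le.1 hlt)
  have h := one_div_le_one_div_of_le (hr K) hle
  linarith [hK₁ K hK]

/-- **★★★ THE HELLINGER LETTER ALONG `K` FROM WILD MASS AND ONE TAME TILT — REGIME-FREE** [folklore; = p618979 `affinityDefectLetter_of_tameTilts` with the
regime `(K₀) (hreg)` and the second branch DELETED].  On the carrier shapes of the key (`T : ℕ → Finset ι`, `A B : ℕ → ℝ → ι → ℝ` positive on `|t| ≤ l₀`):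
wild sets `W K t ⊆ T K`, per-key bounds `wm_K` on BOTH one-run wild masses with `Σ_K √wm_K < ∞` ((V‑a)), tilt radii `r_K > 0` with `Σ_K 1∕r_K < ∞` ((V‑b)),
ONE bound `𝔅 ≥ 0` and, at every `(K,t)`, ONE branch of `log (Σ_{T∖W} A e^{z(log B − log A)} ∕ Σ_{T∖W} A)` on `closedBall 0 r_K` bounded by `𝔅` ((KR) on
tame components) ⇒ `∃ η ≥ 0` with `Σ_K √η_K < ∞` and `1 − Σ_{T K} √(p_{A,K,t}·p_{B,K,t}) ≤ η_K` for all `K`, `|t| ≤ l₀` — the (H) letter consumed by the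
landed class-law ∕ TV roads and by dag-n20-w5's capstone `exists_hybridNE7_of_affinityDefectLetter_and_response`.
`η_K = wm_K + 2𝔅∕r_K² (+ 1 on the finite head where r_K < 2)`.  NO regime letter; NO second branch. -/
theorem affinityDefectLetter_of_tameTilt (T : ℕ → Finset ι) (A B : ℕ → ℝ → ι → ℝ)
    (hA : ∀ K t, |t| ≤ l₀ → ∀ τ ∈ T K, 0 < A K t τ) (hB : ∀ K t, |t| ≤ l₀ → ∀ τ ∈ T K, 0 < B K t τ)
    (W : ℕ → ℝ → Finset ι) (hW : ∀ K t, W K t ⊆ T K)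
    (wm : ℕ → ℝ) (hwm : ∀ K, 0 ≤ wm K)
    (hwildA : ∀ K t, |t| ≤ l₀ → (∑ τ ∈ W K t, A K t τ) / (∑ σ ∈ T K, A K t σ) ≤ wm K)
    (hwildB : ∀ K t, |t| ≤ l₀ → (∑ τ ∈ W K t, B K t τ) / (∑ σ ∈ T K, B K t σ) ≤ wm K)
    (hws : Summable fun K => Real.sqrt (wm K))
    (r : ℕ → ℝ) (hr : ∀ K, 0 < r K) (hrs : Summable fun K => 1 / r K)
    {𝔅 : ℝ} (h𝔅 : 0 ≤ 𝔅)
    (htilt : ∀ K t, |t| ≤ l₀ → ∃ φ : ℂ → ℂ,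
      DifferentiableOn ℂ φ (Metric.closedBall 0 (r K)) ∧
      (∀ s ∈ Metric.closedBall (0:ℂ) (r K), Complex.exp (φ s)
        = (∑ τ ∈ T K \ W K t, (A K t τ : ℂ) * Complex.exp (s * ((Real.log (B K t τ) - Real.log (A K t τ) : ℝ) : ℂ)))
            / ∑ τ ∈ T K \ W K t, (A K t τ : ℂ)) ∧
      (∀ s ∈ Metric.closedBall (0:ℂ) (r K), ‖φ s‖ ≤ 𝔅)) :
    ∃ η : ℕ → ℝ, (∀ K, 0 ≤ η K) ∧ Summable (fun K => Real.sqrt (η K)) ∧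
      ∀ K t, |t| ≤ l₀ →
        1 - ∑ τ ∈ T K, Real.sqrt ((A K t τ / ∑ σ ∈ T K, A K t σ) * (B K t τ / ∑ σ ∈ T K, B K t σ)) ≤ η K := by
  -- the finite head: `r_K ≥ 2` from some `K₁` on
  obtain ⟨K₁, hK₁⟩ := exists_forall_two_le_of_summable_one_div hr hrs
  refine ⟨fun K => wm K + 2 * 𝔅 / r K ^ 2 + (if K < K₁ then (1:ℝ) else 0), ?_, ?_, ?_⟩
  · intro K
    have hwmK := hwm K
    have hrK := hr K
    have hind : 0 ≤ (if K < K₁ then (1:ℝ) else 0) := by split_ifs <;> norm_num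
    positivity
  · -- `√η_K ≤ √wm_K + √(2𝔅)·(1∕r_K) + 𝟙[K < K₁]`, each summable (`√(a + b) ≤ √a + √b` inlined, as in p618979)
    have hsub : ∀ {a b : ℝ}, 0 ≤ a → 0 ≤ b → Real.sqrt (a + b) ≤ Real.sqrt a + Real.sqrt b := fun {a b} ha hb => by
      rw [Real.sqrt_le_left (by positivity)]
      nlinarith [Real.sq_sqrt ha, Real.sq_sqrt hb, mul_nonneg (Real.sqrt_nonneg a) (Real.sqrt_nonneg b)]
    have hhead : Summable fun K => (if K < K₁ then (1:ℝ) else 0) := by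
      refine summable_of_ne_finset_zero (s := Finset.range K₁) fun K hK => ?_
      rw [Finset.mem_range] at hK
      simp [hK]
    refine Summable.of_nonneg_of_le (fun K => Real.sqrt_nonneg _) (fun K => ?_)
      ((hws.add (hrs.mul_left (Real.sqrt (2 * 𝔅)))).add hhead)
    have hrK := hr K
    have hwmK := hwm K
    have hind : 0 ≤ (if K < K₁ then (1:ℝ) else 0) := by split_ifs <;> norm_num
    have hind' : Real.sqrt (if K < K₁ then (1:ℝ) else 0) = (if K < K₁ then (1:ℝ) else 0) := by
      split_ifs <;> simp
    have hq0 : (0:ℝ) ≤ 2 * 𝔅 / r K ^ 2 := by positivity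
    have hs0 : (0:ℝ) ≤ wm K + 2 * 𝔅 / r K ^ 2 := by positivity
    calc Real.sqrt (wm K + 2 * 𝔅 / r K ^ 2 + (if K < K₁ then (1:ℝ) else 0))
        ≤ Real.sqrt (wm K + 2 * 𝔅 / r K ^ 2) + Real.sqrt (if K < K₁ then (1:ℝ) else 0) := hsub hs0 hind
      _ ≤ (Real.sqrt (wm K) + Real.sqrt (2 * 𝔅 / r K ^ 2)) + (if K < K₁ then (1:ℝ) else 0) := by
          rw [hind']; exact add_le_add (hsub hwmK hq0) le_rfl
      _ = Real.sqrt (wm K) + Real.sqrt (2 * 𝔅) * (1 / r K) + (if K < K₁ then (1:ℝ) else 0) := by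
          rw [Real.sqrt_div' _ (by positivity : (0:ℝ) ≤ r K ^ 2), Real.sqrt_sq hrK.le]; ring
  · intro K t ht
    beta_reduce
    have hind : 0 ≤ (if K < K₁ then (1:ℝ) else 0) := by split_ifs <;> norm_num
    have hrK := hr K
    by_cases hK : K < K₁
    · -- on the finite head the letter is the trivial bound `1 − 𝒜 ≤ 1`
      simp only [hK, if_true]
      have h0 : 0 ≤ ∑ τ ∈ T K, Real.sqrt ((A K t τ / ∑ σ ∈ T K, A K t σ) * (B K t τ / ∑ σ ∈ T K, B K t σ)) :=
        sum_nonneg fun _ _ => Real.sqrt_nonneg _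
      have : 0 ≤ 2 * 𝔅 / r K ^ 2 := by positivity
      linarith [hwm K]
    · simp only [hK, if_false, add_zero]
      obtain ⟨φ, hφ, he, hbφ⟩ := htilt K t ht
      have h1 := one_sub_affinity_classLaw_le_wildMass_add_tameTilt (T := T K) (hW K t) (hA K t ht) (hB K t ht)
        (hK₁ K (not_lt.1 hK)) φ hφ he hbφ
      have hmax : max ((∑ τ ∈ W K t, A K t τ) / ∑ σ ∈ T K, A K t σ) ((∑ τ ∈ W K t, B K t τ) / ∑ σ ∈ T K, B K t σ) ≤ wm K :=
        max_le (hwildA K t ht) (hwildB K t ht)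
      linarith

/-- **★★ DROP-IN EDITION: p618979's `affinityDefectLetter_of_tameTilts` WITH THE REGIME DELETED** [folklore].  The binder list of the K-summation of record
VERBATIM — both branches `φA`, `φB` offered, as its suppliers (p620730 `tiltLetter_of_kpMargin` ×2, p622199, p623082) produce them — with the last two arguments
`(K₀) (hreg)` REMOVED; the second branch is accepted and not used.  A consumer of p618979 switches by deleting two arguments. -/
theorem affinityDefectLetter_of_tameTilts_regimeFree (T : ℕ → Finset ι) (A B : ℕ → ℝ → ι → ℝ)
    (hA : ∀ K t, |t| ≤ l₀ → ∀ τ ∈ T K, 0 < A K t τ) (hB : ∀ K t, |t| ≤ l₀ → ∀ τ ∈ T K, 0 < B K t τ)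
    (W : ℕ → ℝ → Finset ι) (hW : ∀ K t, W K t ⊆ T K)
    (wm : ℕ → ℝ) (hwm : ∀ K, 0 ≤ wm K)
    (hwildA : ∀ K t, |t| ≤ l₀ → (∑ τ ∈ W K t, A K t τ) / (∑ σ ∈ T K, A K t σ) ≤ wm K)
    (hwildB : ∀ K t, |t| ≤ l₀ → (∑ τ ∈ W K t, B K t τ) / (∑ σ ∈ T K, B K t σ) ≤ wm K)
    (hws : Summable fun K => Real.sqrt (wm K))
    (r : ℕ → ℝ) (hr : ∀ K, 0 < r K) (hrs : Summable fun K => 1 / r K)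
    {𝔅 : ℝ} (h𝔅 : 0 ≤ 𝔅)
    (htilt : ∀ K t, |t| ≤ l₀ → ∃ φA φB : ℂ → ℂ,
      DifferentiableOn ℂ φA (Metric.closedBall 0 (r K)) ∧ DifferentiableOn ℂ φB (Metric.closedBall 0 (r K)) ∧
      (∀ s ∈ Metric.closedBall (0:ℂ) (r K), Complex.exp (φA s)
        = (∑ τ ∈ T K \ W K t, (A K t τ : ℂ) * Complex.exp (s * ((Real.log (B K t τ) - Real.log (A K t τ) : ℝ) : ℂ)))
            / ∑ τ ∈ T K \ W K t, (A K t τ : ℂ)) ∧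
      (∀ s ∈ Metric.closedBall (0:ℂ) (r K), Complex.exp (φB s)
        = (∑ τ ∈ T K \ W K t, (B K t τ : ℂ) * Complex.exp (s * ((Real.log (B K t τ) - Real.log (A K t τ) : ℝ) : ℂ)))
            / ∑ τ ∈ T K \ W K t, (B K t τ : ℂ)) ∧
      (∀ s ∈ Metric.closedBall (0:ℂ) (r K), ‖φA s‖ ≤ 𝔅) ∧ (∀ s ∈ Metric.closedBall (0:ℂ) (r K), ‖φB s‖ ≤ 𝔅)) :
    ∃ η : ℕ → ℝ, (∀ K, 0 ≤ η K) ∧ Summable (fun K => Real.sqrt (η K)) ∧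
      ∀ K t, |t| ≤ l₀ →
        1 - ∑ τ ∈ T K, Real.sqrt ((A K t τ / ∑ σ ∈ T K, A K t σ) * (B K t τ / ∑ σ ∈ T K, B K t σ)) ≤ η K :=
  affinityDefectLetter_of_tameTilt T A B hA hB W hW wm hwm hwildA hwildB hws r hr hrs h𝔅 fun K t ht => by
    obtain ⟨φA, _, hφA, -, heA, -, hbA, -⟩ := htilt K t ht
    exact ⟨φA, hφA, heA, hbA⟩

/-- **★ COROLLARY — THE SUMMABLE HELLINGER RATE, REGIME-FREE** [folklore]: under the hypotheses of `affinityDefectLetter_of_tameTilt` there is a SUMMABLE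
`ρ ≥ 0` with `√(1 − Σ_{T K} √(p_{A,K,t}·p_{B,K,t})) ≤ ρ_K` for all `K` and `|t| ≤ l₀` (p618979 `exists_summable_sqrt_rate`) — the input shape of the per-set-TV ∕
class-law roads (dag-n19-w2 p612301, dag-n20-w4 p609004, dag-n20-w5's endpoint road). -/
theorem hellingerRate_of_tameTilt (T : ℕ → Finset ι) (A B : ℕ → ℝ → ι → ℝ)
    (hA : ∀ K t, |t| ≤ l₀ → ∀ τ ∈ T K, 0 < A K t τ) (hB : ∀ K t, |t| ≤ l₀ → ∀ τ ∈ T K, 0 < B K t τ)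
    (W : ℕ → ℝ → Finset ι) (hW : ∀ K t, W K t ⊆ T K)
    (wm : ℕ → ℝ) (hwm : ∀ K, 0 ≤ wm K)
    (hwildA : ∀ K t, |t| ≤ l₀ → (∑ τ ∈ W K t, A K t τ) / (∑ σ ∈ T K, A K t σ) ≤ wm K)
    (hwildB : ∀ K t, |t| ≤ l₀ → (∑ τ ∈ W K t, B K t τ) / (∑ σ ∈ T K, B K t σ) ≤ wm K)
    (hws : Summable fun K => Real.sqrt (wm K))
    (r : ℕ → ℝ) (hr : ∀ K, 0 < r K) (hrs : Summable fun K => 1 / r K)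
    {𝔅 : ℝ} (h𝔅 : 0 ≤ 𝔅)
    (htilt : ∀ K t, |t| ≤ l₀ → ∃ φ : ℂ → ℂ,
      DifferentiableOn ℂ φ (Metric.closedBall 0 (r K)) ∧
      (∀ s ∈ Metric.closedBall (0:ℂ) (r K), Complex.exp (φ s)
        = (∑ τ ∈ T K \ W K t, (A K t τ : ℂ) * Complex.exp (s * ((Real.log (B K t τ) - Real.log (A K t τ) : ℝ) : ℂ)))
            / ∑ τ ∈ T K \ W K t, (A K t τ : ℂ)) ∧
      (∀ s ∈ Metric.closedBall (0:ℂ) (r K), ‖φ s‖ ≤ 𝔅)) :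
    ∃ ρ : ℕ → ℝ, Summable ρ ∧ (∀ K, 0 ≤ ρ K) ∧ ∀ K t, |t| ≤ l₀ →
      Real.sqrt (1 - ∑ τ ∈ T K, Real.sqrt ((A K t τ / ∑ σ ∈ T K, A K t σ) * (B K t τ / ∑ σ ∈ T K, B K t σ))) ≤ ρ K := by
  obtain ⟨η, _, hs, hη⟩ := affinityDefectLetter_of_tameTilt T A B hA hB W hW wm hwm hwildA hwildB hws r hr hrs h𝔅 htilt
  exact exists_summable_sqrt_rate hs hη

end Summation

/-! ## §4 Toy (A6): the letters of §2 are jointly inhabited [folklore] -/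

section Toy

/-- **TOY — IDENTICAL RUNS** (A6 non-vacuity of §2's letter list): one class, `A = B = 1`, `W = ∅`, the branch `φ = 0` on `closedBall 0 2` (`e^0 = 1 = Σ 1·e^{z·0} ∕ Σ 1`),
`𝔅 = 0`: every hypothesis of `one_sub_affinity_classLaw_le_wildMass_add_tameTilt` holds and it returns `1 − 𝒜 ≤ max(0,0) + 0`, i.e. `𝒜 = 1` — tight. -/
theorem toy_identicalRuns :
    1 - ∑ τ ∈ (Finset.univ : Finset Unit), Real.sqrt (((fun _ => (1:ℝ)) τ / ∑ σ ∈ (Finset.univ : Finset Unit), (fun _ => (1:ℝ)) σ)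
        * ((fun _ => (1:ℝ)) τ / ∑ σ ∈ (Finset.univ : Finset Unit), (fun _ => (1:ℝ)) σ))
      ≤ max ((∑ τ ∈ (∅ : Finset Unit), (fun _ => (1:ℝ)) τ) / ∑ σ ∈ (Finset.univ : Finset Unit), (fun _ => (1:ℝ)) σ)
            ((∑ τ ∈ (∅ : Finset Unit), (fun _ => (1:ℝ)) τ) / ∑ σ ∈ (Finset.univ : Finset Unit), (fun _ => (1:ℝ)) σ)
        + 2 * 0 / (2:ℝ) ^ 2 := by
  refine one_sub_affinity_classLaw_le_wildMass_add_tameTilt (T := (Finset.univ : Finset Unit)) (W := ∅)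
    (A := fun _ => (1:ℝ)) (B := fun _ => (1:ℝ)) (Finset.empty_subset _) (fun _ _ => one_pos) (fun _ _ => one_pos)
    (le_refl (2:ℝ)) (fun _ => 0) (differentiableOn_const 0) (fun s _ => ?_) (fun s _ => by simp)
  simp

end Toy

end Summit.QuantumFields.YangMills.BalabanUVNodes.N19TameHellingerLetterRegimeFree

end
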